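/-
Copyright: public-audit package `pub-balaban` (b2b-balaban), seat t4-ne2-p2-g3. Released under Apache 2.0 like Mathlib.
-/
import Mathlib
import Literature.MathematicalPhysics.QuantumFieldTheory.Balaban1983to89.T4GaugeActionRateStrip
import Literature.MathematicalPhysics.QuantumFieldTheory.Balaban1983to89.B6Cov2156Subset166
import Literature.MathematicalPhysics.QuantumFieldTheory.King1986.CovarianceRate
import Literature.MathematicalPhysics.QuantumFieldTheory.Balaban1983to89.T4EtaRateMin

/-!
# King's Lemma 4.5 for Bałaban's gauge-field fluctuation covariance C^{(k)} = C(C*Δ_kC)⁻¹C* (B6 (2.156)) at U = 1: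
the η-RATE of the unit-lattice covariance, hypothesis-free on every unit torus and every sub-family / Λ ⊂ T

Sources (locations; the statements proved here are NOT printed): T. Bałaban, *Propagators and renormalization
transformations for lattice gauge theories. II*, Commun. Math. Phys. **96** (1984) 223–250 [B6,
`Balaban1984PropagatorsII`], (2.152)–(2.157) pp. 249–250; *… I*, Commun. Math. Phys. **95** (1984) 17–40 [B5,
`Balaban1984PropagatorsI`], (1.66) p. 29; C. King, *The U(1) Higgs model. I. The continuum limit*, Commun. Math. Phys.
**102** (1986) 649–677 [`King1986`], Lemma 4.5 (4.38) p. 674 with its proof pp. 674–675.  Quotations below were read by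
this seat from the ×2 page renders `run/shared/lean/pub/pub-balaban/b2b-balaban-ref1/pages/1984-cmp96-propagators-rt-II/
1984-cmp96-propagators-rt-II-p027-x2.png` (p. 249), `…-p028-x2.png` (p. 250) (journal page = PDF page + 222) and
`b2b-balaban-template/king-renders/1986-cmp102-king-u1-higgs-I-p026-x2.png` (King p. 674), read as images, not from an
OCR layer.

CITATION HEADER (lean-in-tree rule).  Cell `pub-balaban`, unit `b2b-balaban-t4-ne2-p2-g3` (T⁴-continuum fan-out, NE2
prover seat P2, generation 3; journal row `T4-U1a.E-NE2-PROVE-P2c*`, self-assigned under the yield clause).  Siblings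
imported BY NAME, none edited: `…T4GaugeActionRateStrip` (this lineage, gen 2, p184766: `ksum_rate` — the position-space
rate WITH decay of the torus kernels of the (1.66) symbol, from the strip continuation; `CWs`), `…B6Cov2156Subset166`
(unit pv09-g6, p184640: `cov2156_torusS_166`) and through it `…B6Cov2156TorusSubset` (pv09-g6, p184144: `elimTS`,
`subFamilyT`, `q1_elimTS_mulVec`, `elimTS_mulVec_tree`, `elimTS_iso`, `bondReductionLam`), `…B6Cov2156Torus` (pv09-g6:
`elimT`, `freeT`,
THE matrix of the (1.66) form `deltaPol`, `represents_deltaPol`, `bondReductionT`, (2.153) on the torus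
`lowerOnConstrainedT_of_represents`, `gamma2153`), `…B5Kernel166Decay` (unit b05-g9, p184553: `ksum`, `inner_eq`,
`deltaPol_eq_sum`, `kernelDecay166`, `cov2156_torus_166`), `…B6BondEliminationTorus` (pv09-g4: the periodic distance
`pdist`, the torus profile `perSum_le`, `box_separated`), `…B6BondElimination` (b06-g3: `SubReduction.cov`,
`isUnit_det_of_lower`), `…B6FromB4` (`sandwich_lowerBound`), and `King1986.CovarianceRate` (template lineage g8, p179169:
`triple_decay_bound`, `pseudo_nonneg`, `exp_decay_mono` — King's (4.40)–(4.41) mechanism over an arbitrary finite index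
set).  Scalar sibling, NOT imported: `King1986.CovarianceRateTorus.king_lemma45_torus` (template g10, p181229) is King's
own (4.38) for King's scalar covariance (4.32) on tori; the present file is the analogue for Bałaban's GAUGE-FIELD
covariance (2.156), which differs in the object (δ-function constraints, C(C*Δ_kC)⁻¹C*, instead of the mass term
aL⁻²Q*Q) and in the kernel input (the strip continuation of the (1.66) symbol instead of King's (3.20) symbols).

## What is printed (verbatim)

* [B6] p. 249: *"Let us denote the covariance of the Gaussian integration in (2.152) by C^{(k)}, or by C^{(k)}_Λ,
  hence  ∫dB↾_Λ δ(QB) δ_{Ax}(B) e^{−½⟨B,Δ_kB⟩+⟨J,B⟩} = Z^{(k)} e^{½⟨J,C^{(k)}_Λ J⟩}.  (2.154)"*; p. 250: *"hence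
  C^{(k)}_Λ = C(C*Δ_kC)^{−1}C*.  (2.156)  By the definition of C we have of course that CB′ = 0 outside Λ, QCB′ = 0,
  (CB′)(Γ_{y,x}) = 0, x ∈ B(y), y ∈ Λ′, for arbitrary B′. The inequality (2.153) implies
  ⟨B′, C*Δ_kCB′⟩ ≥ (γ₀/12d²)L^{−d−1}‖CB′‖² ≥ γ′₀‖B′‖²,  (2.157)  where γ′₀ = (γ₀/12d²)L^{−d−1}. C is a short-ranged
  operator, so C*Δ_kC has the same exponential decay as Δ_k. Now we may apply the theory developed in Sect. 5 of [3]
  on unit lattice operators. It gives us an exponential decay, and all the other properties, for the operator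
  (C*Δ_kC)^{−1}, hence for C^{(k)}_Λ also. Such a scheme will be applied in the future to investigate all unit lattice
  propagators defined by generalizations of the integrals (2.152), (2.154)."*
* [King1986] p. 674: *"Lemma 4.5.  |C^{(k)}(x, y) − C^{(k+n)}(x, y)| ≤ CL^{−k}e^{−δ₀|x−y|}.  (4.38)  Proof. We prove
  (4.38) in a finite volume Ω with periodic boundary conditions; …"* — printed for King's SCALAR covariance
  (sΔ^{(k)} + (1−s)Δ^{(k+n)} + aL^{−2}Q*Q)^{−1} (4.32) at A = 0, d = 2, 3.

## What this file proves (kernel-checked, no `sorry`; NOTHING below is printed — it is the cell's estimate NE2 (T4-DAG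
§6, node U1a) for ONE MORE U = 1 object, King's (4.38) SHAPE for Bałaban's (2.156))

For the covariance C^{(k)} = C(C*Δ_kC)⁻¹C* of (2.156) built on THE matrix `deltaPol M n` of the (1.66) form at level
n (n = L^k is how k enters Δ_k), with the EXPLICIT elimination matrix C of p. 250 (`elimT`; δ(QB) with the torus
average, δ_{Ax} on every block) or any column sub-family C_S of it (`elimTS`, in particular the Λ-bonds C_Λ of every
Λ = B(Λ′₀) ⊂ T, `bondReductionLam`), on every unit torus T = Z^d/(M₁Z × ⋯ × M_dZ) with L ∣ M_i:

* §1 `kernelRate166` — the RATE companion of `B5Kernel166Decay.kernelDecay166`: there are θ₀, δ₁ > 0 depending on d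
  only with |Δ^{(n₂)}(b,b′) − Δ^{(n₁)}(b,b′)| ≤ θ₀·n₁⁻¹·e^{−δ₁ρ_M(b₋,b′₋)} for all tori, all levels n₁ ≥ 1, n₂ = Rn₁
  (R ≥ 1), all bonds (Δ^{(n)} = `deltaPol M n`; from this lineage's `T4GaugeActionRateStrip.ksum_rate` through b05-g9's
  bond-basis dictionary `deltaPol_eq_sum` / `inner_eq`).
* §2 the generic RESOLVENT IDENTITY FOR CONSTRAINED COVARIANCES over arbitrary finite index types:
  E(EᵀΔ₁E)⁻¹Eᵀ − E(EᵀΔ₂E)⁻¹Eᵀ = [E(EᵀΔ₁E)⁻¹Eᵀ]·(Δ₂ − Δ₁)·[E(EᵀΔ₂E)⁻¹Eᵀ] (`redCov_sub`) — King's endpoint identity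
  behind (4.39)–(4.40) with the δ-function constraints of (2.152) in place of King's aL⁻²Q*Q — and its consequence
  `redCov_rate`: two decaying constrained covariances around a small decaying middle factor give King's (4.41) bound
  (`King1986.triple_decay_bound`).
* §3–§4 the ASSEMBLY, hypothesis-free: `cov2156_rate_subfamily` / `cov2156_rate_torus` / `cov2156_rate_lam` — there are
  C′, δ′ > 0 depending on (d, L) only such that for every torus (L ∣ M_i), all levels n₁ ≥ 1, n₂ = Rn₁ (R ≥ 1), every
  sub-family S (resp. the whole family, resp. every Λ′₀) and all bonds b, b′:
  |C_S^{(n₂)}(b,b′) − C_S^{(n₁)}(b,b′)| ≤ C′·n₁⁻¹·e^{−δ′ρ_M(b₋,b′₋)};  and the KING SHAPE (4.38) `…_king`: n₁ = L^k,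
  n₂ = L^{k+m} ⟹ ≤ C′·L^{−k}·e^{−δ′ρ_M(b₋,b′₋)}, uniformly in k, m, the torus, S.  Together with the decay
  (`cov2156_torusS_166`, `cov2156_torus_166`) this is the (uniform decay, one-step rate) PAIR for the cell's LIAISON-U1
  primitive P1 «Γ_k = C^{(k)}(𝟙)» at U = 1 (`cov2156_pair_torus`).

* §5 the cell's TYPED SHAPE: the readings k ↦ C^{(k)}(b,b′) on a fixed torus form an instance `covReadings` of
  `T4EtaRateMin.Readings` and SATISFY `T4EtaRateMin.LocalRate` with one constant B₀(d, L) and rate θ = L⁻¹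
  (`cov2156_localRate`, a theorem, not a hypothesis); hence, for L ≥ 2, King's use of (4.38): every entry C^{(k)}(b,b′)
  converges as k → ∞ on each fixed unit torus, with geometric tail (`cov2156_entry_limit`).

Invertibility of C_S*Δ_kC_S is (2.157) (`lowerOnConstrainedT_of_represents` + `elimTS_iso` +
`B6BondElimination.isUnit_det_of_lower`); the decay of both endpoint covariances is pv09/b05's kernel chain (Sect. 5 of
[3] on tori); the volume-independent sums are `B6BondEliminationTorus.perSum_le`.  No `def … : Prop` hypothesis is
introduced; every declaration is a definition with a body or a proved theorem.

HONEST SCOPE.  (i) Finite unit tori only, U = 1 only (no background field: NOT the cell's NE2⁺), the (1.66) form's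
matrix (the identification (1.65) = (1.66) as OPERATORS is not certified package-wide, see `B5Bounds167Lattice`);
(ii) the constants are crude and existential ((d, L) only) — King prints CL^{−k} with unspecified C, δ₀ as well;
(iii) the rate n₁⁻¹ (King's L^{−k}, γ = 1) comes from the strip continuation of the (1.66) symbol at a quarter of its
analyticity width (`ksum_rate`), the final decay rate is half the common decay rate (King's (4.41) halving); (iv) this is
NOT the η-rate of H_k, G = Δ_a⁻¹ or P (cell objects X9–X11), NOT infinite volume, NOT a continuum limit, NOT a statement
about the 4-d Yang–Mills measure.  Value = one more unit-lattice η-rate at U = 1 in kernel form; NOT summit progress.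
-/

noncomputable section

open Finset Matrix

namespace Literature.MathematicalPhysics.QuantumFieldTheory.Balaban1983to89.T4Cov2156Rate

open Literature.MathematicalPhysics.QuantumFieldTheory.King1986 (triple_decay_bound pseudo_nonneg exp_decay_mono)
open B4TorusKernel (periodConst)
open B4TorusKernel.MultiPeriod (torusSupNorm)
open B5Prop11Plancherel (Tor)
open B5Symbol166Strip (kappa166 kappa166_pos MG MG_pos)
open B6Lemma24Torus (pbox)
open B6BondEliminationTorus (pdist perSum_le box_separated zdPer)
open B6BondElimination (SubReduction isUnit_det_of_lower)
open B6LowerBound2153Torus (toT)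
open B6Cov2156Torus (freeT elimT phiC wgt deltaPol deltaPol_isSymm represents_deltaPol bondReductionT
  bondReductionT_cov lowerOnConstrainedT_of_represents gamma2153 gamma2153_pos one_le_M LowerOnConstrainedT
  q1_elimT_mulVec elimT_mulVec_tree elimT_iso)
open B6Cov2156TorusSubset (elimTS subFamilyT subFamilyT_cov q1_elimTS_mulVec elimTS_mulVec_tree elimTS_iso
  bondReductionLam lamFree lamFree_subset)
open B6Cov2156Subset166 (cov2156_torusS_166)
open B5Kernel166Decay (ksum inner_eq inner_eq_zero_of_eq deltaPol_eq_sum toT_sub kernelDecay166 cov2156_torus_166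
  pdist_le_torusSupNorm periodConst_pos)
open T4GaugeActionRateStrip (CWs CWs_nonneg ksum_rate)
open T4EtaRateMin (Readings LocalRate)

variable {d : ℕ}

/-! ## §1  The rate companion of `kernelDecay166`: |Δ^{(n₂)}(b,b′) − Δ^{(n₁)}(b,b′)| ≤ θ₀ n₁⁻¹ e^{−δ₁ρ_M(b₋,b′₋)} -/

section KernelRate

variable (M : Fin d → ℕ) [hM : ∀ μ, NeZero (M μ)]

/-- The difference of the `(μ, ν)` terms of `deltaPol` at two levels is dominated by the four entry-kernel
differences (the indicator coefficients of `inner_eq` are `≤ 1` and common to both levels). [folklore] -/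
theorem abs_inner_sub_le (n₁ n₂ : ℕ) (p q : B4.Idx (pbox M) d) (μ ν : Fin d) :
    |(∑ t : Tor M, wgt M n₂ ((μ, ν), t) *
        ((starRingEnd ℂ) (phiC M (Pi.single p 1) μ ν t) * phiC M (Pi.single q 1) μ ν t).re)
      - ∑ t : Tor M, wgt M n₁ ((μ, ν), t) *
        ((starRingEnd ℂ) (phiC M (Pi.single p 1) μ ν t) * phiC M (Pi.single q 1) μ ν t).re|
      ≤ ‖ksum M n₂ μ ν μ μ (toT M (p.1 : Fin d → ℤ) - toT M (q.1 : Fin d → ℤ))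
          - ksum M n₁ μ ν μ μ (toT M (p.1 : Fin d → ℤ) - toT M (q.1 : Fin d → ℤ))‖
        + ‖ksum M n₂ μ ν μ ν (toT M (p.1 : Fin d → ℤ) - toT M (q.1 : Fin d → ℤ))
          - ksum M n₁ μ ν μ ν (toT M (p.1 : Fin d → ℤ) - toT M (q.1 : Fin d → ℤ))‖
        + ‖ksum M n₂ μ ν ν μ (toT M (p.1 : Fin d → ℤ) - toT M (q.1 : Fin d → ℤ))
          - ksum M n₁ μ ν ν μ (toT M (p.1 : Fin d → ℤ) - toT M (q.1 : Fin d → ℤ))‖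
        + ‖ksum M n₂ μ ν ν ν (toT M (p.1 : Fin d → ℤ) - toT M (q.1 : Fin d → ℤ))
          - ksum M n₁ μ ν ν ν (toT M (p.1 : Fin d → ℤ) - toT M (q.1 : Fin d → ℤ))‖ := by
  rw [inner_eq, inner_eq, ← Complex.sub_re]
  refine (Complex.abs_re_le_norm _).trans ?_
  set z := toT M (p.1 : Fin d → ℤ) - toT M (q.1 : Fin d → ℤ) with hz
  set A1 := ksum M n₂ μ ν μ μ z
  set A2 := ksum M n₂ μ ν μ ν z
  set A3 := ksum M n₂ μ ν ν μ z
  set A4 := ksum M n₂ μ ν ν ν z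
  set B1 := ksum M n₁ μ ν μ μ z
  set B2 := ksum M n₁ μ ν μ ν z
  set B3 := ksum M n₁ μ ν ν μ z
  set B4 := ksum M n₁ μ ν ν ν z
  set a := ((B5Kernel166Decay.dirInd M ν p : ℝ) : ℂ)
  set b := ((B5Kernel166Decay.dirInd M ν q : ℝ) : ℂ)
  set c := ((B5Kernel166Decay.dirInd M μ p : ℝ) : ℂ)
  set e := ((B5Kernel166Decay.dirInd M μ q : ℝ) : ℂ)
  have ha : ‖a‖ ≤ 1 := B5Kernel166Decay.norm_dirInd_le M ν p
  have hb : ‖b‖ ≤ 1 := B5Kernel166Decay.norm_dirInd_le M ν q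
  have hc : ‖c‖ ≤ 1 := B5Kernel166Decay.norm_dirInd_le M μ p
  have he : ‖e‖ ≤ 1 := B5Kernel166Decay.norm_dirInd_le M μ q
  have hι : ∀ (s s' K : ℂ), ‖s‖ ≤ 1 → ‖s'‖ ≤ 1 → ‖s * s' * K‖ ≤ ‖K‖ := by
    intro s s' K hs hs'
    rw [norm_mul, norm_mul]
    have hK := norm_nonneg K
    have hs0 := norm_nonneg s
    have hs0' := norm_nonneg s'
    calc ‖s‖ * ‖s'‖ * ‖K‖ ≤ 1 * 1 * ‖K‖ := by gcongr
      _ = ‖K‖ := by ring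
  have hre : a * b * A1 - a * e * A2 - c * b * A3 + c * e * A4 - (a * b * B1 - a * e * B2 - c * b * B3 + c * e * B4)
      = a * b * (A1 - B1) - a * e * (A2 - B2) - c * b * (A3 - B3) + c * e * (A4 - B4) := by ring
  rw [hre]
  calc ‖a * b * (A1 - B1) - a * e * (A2 - B2) - c * b * (A3 - B3) + c * e * (A4 - B4)‖
      ≤ ‖a * b * (A1 - B1) - a * e * (A2 - B2) - c * b * (A3 - B3)‖ + ‖c * e * (A4 - B4)‖ := norm_add_le _ _
    _ ≤ ‖a * b * (A1 - B1) - a * e * (A2 - B2)‖ + ‖c * b * (A3 - B3)‖ + ‖c * e * (A4 - B4)‖ := by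
        gcongr
        exact norm_sub_le _ _
    _ ≤ ‖a * b * (A1 - B1)‖ + ‖a * e * (A2 - B2)‖ + ‖c * b * (A3 - B3)‖ + ‖c * e * (A4 - B4)‖ := by
        gcongr
        exact norm_sub_le _ _
    _ ≤ ‖A1 - B1‖ + ‖A2 - B2‖ + ‖A3 - B3‖ + ‖A4 - B4‖ := by
        gcongr
        · exact hι _ _ _ ha hb
        · exact hι _ _ _ ha he
        · exact hι _ _ _ hc hb
        · exact hι _ _ _ hc he

end KernelRate

section KernelRateSucc

/-- The rate constant `θ₀(d)` of `kernelRate166` in dimension `d + 1` (crude: `1 +` King's amplitude summed over the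
`(d+1)²` pairs `(μ, ν)` and the four entry kernels). [folklore] -/
def theta0 (d : ℕ) : ℝ :=
  1 + ((d : ℝ) + 1) * ((d : ℝ) + 1) *
    (4 * (8 * CWs (d + 1) * periodConst (kappa166 (d + 1) / (4 * ((d : ℝ) + 1))) d))

/-- The decay rate `δ₁(d)` of `kernelRate166` in dimension `d + 1`: a quarter of the (1.66) strip width, divided by
the dimension (the torus sup-norm ↔ ρ_M comparison). [folklore] -/
def delta1 (d : ℕ) : ℝ := kappa166 (d + 1) / (4 * ((d : ℝ) + 1)) / ((d : ℝ) + 1)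

/-- `θ₀(d) > 0`. [folklore] -/
theorem theta0_pos (d : ℕ) : 0 < theta0 d := by
  unfold theta0
  have h1 : 0 ≤ CWs (d + 1) := CWs_nonneg _
  have h2 : 0 < periodConst (kappa166 (d + 1) / (4 * ((d : ℝ) + 1))) d := by
    have := kappa166_pos (d + 1)
    exact periodConst_pos (by positivity) d
  positivity

/-- `δ₁(d) > 0`. [folklore] -/
theorem delta1_pos (d : ℕ) : 0 < delta1 d := by
  unfold delta1
  have := kappa166_pos (d + 1)
  positivity

/-- **THE RATE OF THE KERNEL OF Δ_k ON THE TORUS (dimension `d + 1`)**: for every period vector `M`, all levels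
`n₁ ≥ 1`, `n₂ = R·n₁` with `R ≥ 1`, and all bonds `b, b′`:
`|Δ^{(n₂)}(b,b′) − Δ^{(n₁)}(b,b′)| ≤ θ₀(d)·n₁⁻¹·e^{−δ₁(d) ρ_M(b₋,b′₋)}` — from this lineage's `ksum_rate` (strip
continuation of the (1.66) symbol) through the bond-basis dictionary of `B5Kernel166Decay`.  NOT printed (no η-difference
of Δ_k is stated in B5/B6); King's analogue is Lemma 4.3 + (4.41) p. 675 for the scalar Δ^{(k)}.
[cite: King1986, Lemma 4.5 proof (4.40)–(4.41) pp.674–675 (shape); Balaban1984PropagatorsI, (1.66) p.29 (object)] [folklore] -/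
theorem kernelRate166_succ (M : Fin (d + 1) → ℕ) [∀ μ, NeZero (M μ)] {n₁ n₂ R : ℕ} (hn₁ : 1 ≤ n₁) (hR : 1 ≤ R)
    (h : n₂ = R * n₁) (p q : B4.Idx (pbox M) (d + 1)) :
    |deltaPol M n₂ p q - deltaPol M n₁ p q|
      ≤ theta0 d * (n₁ : ℝ)⁻¹ *
          Real.exp (-(delta1 d * pdist M (one_le_M M) (p.1 : Fin (d + 1) → ℤ) (q.1 : Fin (d + 1) → ℤ))) := by
  haveI : NeZero n₁ := ⟨by omega⟩
  haveI : NeZero n₂ := ⟨by subst h; exact Nat.mul_ne_zero (by omega) (by omega)⟩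
  set κ' : ℝ := kappa166 (d + 1) / (4 * ((d : ℝ) + 1)) with hκ'
  have hκ'0 : 0 < κ' := by have := kappa166_pos (d + 1); positivity
  set Amp : ℝ := 8 * CWs (d + 1) * (n₁ : ℝ)⁻¹ * periodConst κ' d with hAmp
  have hAmp0 : 0 ≤ Amp := by
    have h1 : 0 ≤ CWs (d + 1) := CWs_nonneg _
    have h2 : 0 < periodConst κ' d := periodConst_pos hκ'0 d
    positivity
  set x : Fin (d + 1) → ℤ := (p.1 : Fin (d + 1) → ℤ) - (q.1 : Fin (d + 1) → ℤ) with hx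
  -- the four entry-kernel differences, each bounded by `ksum_rate`
  have hK : ∀ {μ ν : Fin (d + 1)}, μ ≠ ν → ∀ a b : Fin (d + 1),
      ‖ksum M n₂ μ ν a b (toT M (p.1 : Fin (d + 1) → ℤ) - toT M (q.1 : Fin (d + 1) → ℤ))
          - ksum M n₁ μ ν a b (toT M (p.1 : Fin (d + 1) → ℤ) - toT M (q.1 : Fin (d + 1) → ℤ))‖
        ≤ Amp * Real.exp (-(κ' / (d + 1) * torusSupNorm M x)) := by
    intro μ ν hμν a b
    rw [toT_sub]
    have := ksum_rate M h hμν a b x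
    simpa [hAmp, hκ', mul_assoc, mul_comm, mul_left_comm] using this
  have hinner : ∀ μ ν : Fin (d + 1),
      |(∑ t : Tor M, wgt M n₂ ((μ, ν), t) *
          ((starRingEnd ℂ) (phiC M (Pi.single p 1) μ ν t) * phiC M (Pi.single q 1) μ ν t).re)
        - ∑ t : Tor M, wgt M n₁ ((μ, ν), t) *
          ((starRingEnd ℂ) (phiC M (Pi.single p 1) μ ν t) * phiC M (Pi.single q 1) μ ν t).re|
        ≤ 4 * (Amp * Real.exp (-(κ' / (d + 1) * torusSupNorm M x))) := by
    intro μ ν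
    by_cases hμν : μ = ν
    · subst hμν
      rw [inner_eq_zero_of_eq, inner_eq_zero_of_eq, sub_zero, abs_zero]
      exact mul_nonneg (by norm_num) (mul_nonneg hAmp0 (Real.exp_nonneg _))
    · refine (abs_inner_sub_le M n₁ n₂ p q μ ν).trans ?_
      have h1 := hK hμν μ μ
      have h2 := hK hμν μ ν
      have h3 := hK hμν ν μ
      have h4 := hK hμν ν ν
      linarith
  rw [deltaPol_eq_sum, deltaPol_eq_sum, ← Finset.sum_sub_distrib]
  refine (?_ : _ ≤ ∑ _μ : Fin (d + 1), ∑ _ν : Fin (d + 1),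
      4 * (Amp * Real.exp (-(κ' / (d + 1) * torusSupNorm M x)))).trans ?_
  · refine (Finset.abs_sum_le_sum_abs _ _).trans (Finset.sum_le_sum fun μ _ => ?_)
    rw [← Finset.sum_sub_distrib]
    exact (Finset.abs_sum_le_sum_abs _ _).trans (Finset.sum_le_sum fun ν _ => hinner μ ν)
  rw [Finset.sum_const, Finset.sum_const, Finset.card_univ, Fintype.card_fin, nsmul_eq_mul, nsmul_eq_mul]
  push_cast
  -- compare the torus sup-norm with ρ_M and unfold the constants
  have hexp : Real.exp (-(κ' / (d + 1) * torusSupNorm M x))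
      ≤ Real.exp (-(delta1 d * pdist M (one_le_M M) (p.1 : Fin (d + 1) → ℤ) (q.1 : Fin (d + 1) → ℤ))) := by
    apply Real.exp_le_exp.mpr
    have hp := pdist_le_torusSupNorm M (p.1 : Fin (d + 1) → ℤ) (q.1 : Fin (d + 1) → ℤ)
    have hk : 0 < κ' / ((d : ℝ) + 1) := div_pos hκ'0 (by positivity)
    have : delta1 d = κ' / ((d : ℝ) + 1) := by simp [delta1, hκ']
    rw [this]
    exact neg_le_neg (mul_le_mul_of_nonneg_left hp hk.le)
  have hn0 : 0 < (n₁ : ℝ)⁻¹ := by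
    have : (0 : ℝ) < n₁ := by exact_mod_cast (show 0 < n₁ by omega)
    positivity
  have hd1 : (0 : ℝ) ≤ (d : ℝ) + 1 := by positivity
  set P := periodConst κ' d with hP
  have hP0 : 0 < P := periodConst_pos hκ'0 d
  have hC0 : 0 ≤ CWs (d + 1) := CWs_nonneg _
  set Ex := Real.exp (-(delta1 d * pdist M (one_le_M M) (p.1 : Fin (d + 1) → ℤ) (q.1 : Fin (d + 1) → ℤ)))
    with hEx
  have hEx0 : 0 ≤ Ex := Real.exp_nonneg _
  have step1 : ((d : ℝ) + 1) * (((d : ℝ) + 1) * (4 * (Amp * Real.exp (-(κ' / (d + 1) * torusSupNorm M x)))))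
      ≤ ((d : ℝ) + 1) * (((d : ℝ) + 1) * (4 * (Amp * Ex))) := by
    gcongr
  refine step1.trans ?_
  have hθ : ((d : ℝ) + 1) * (((d : ℝ) + 1) * (4 * (Amp * Ex)))
      = (((d : ℝ) + 1) * ((d : ℝ) + 1) * (4 * (8 * CWs (d + 1) * P))) * (n₁ : ℝ)⁻¹ * Ex := by
    simp only [hAmp]
    ring
  rw [hθ]
  have hle : ((d : ℝ) + 1) * ((d : ℝ) + 1) * (4 * (8 * CWs (d + 1) * P)) ≤ theta0 d := by
    show _ ≤ 1 + _
    have : (0 : ℝ) ≤ 1 := by norm_num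
    linarith
  have := mul_le_mul_of_nonneg_right (mul_le_mul_of_nonneg_right hle hn0.le) hEx0
  exact this

/-- **`kernelRate166` in any dimension `d ≥ 1`**, existential constants depending on `d` only. [folklore] -/
theorem kernelRate166 (hd : 1 ≤ d) : ∃ θ₀ δ₁ : ℝ, 0 < θ₀ ∧ 0 < δ₁ ∧
    ∀ (M : Fin d → ℕ) [∀ μ, NeZero (M μ)] (n₁ n₂ R : ℕ), 1 ≤ n₁ → 1 ≤ R → n₂ = R * n₁ →
      ∀ p q : B4.Idx (pbox M) d, |deltaPol M n₂ p q - deltaPol M n₁ p q|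
        ≤ θ₀ * (n₁ : ℝ)⁻¹ * Real.exp (-(δ₁ * pdist M (one_le_M M) (p.1 : Fin d → ℤ) (q.1 : Fin d → ℤ))) := by
  obtain ⟨e, rfl⟩ : ∃ e, d = e + 1 := ⟨d - 1, by omega⟩
  exact ⟨theta0 e, delta1 e, theta0_pos e, delta1_pos e,
    fun M _ n₁ n₂ R hn₁ hR h p q => kernelRate166_succ M hn₁ hR h p q⟩

end KernelRateSucc

/-! ## §2  The resolvent identity for constrained covariances and King's (4.40)–(4.41) bound, over arbitrary finite
index types -/

section Core

variable {ι S : Type*} [Fintype ι] [Fintype S] [DecidableEq S]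

/-- The constrained ("reduced") covariance `E (EᵀΔE)⁻¹ Eᵀ` — the shape of (2.156) `C(C*Δ_kC)⁻¹C*` with `E` = the
elimination matrix. [cite: Balaban1984PropagatorsII, (2.156) p.250] -/
def redCov (E : Matrix ι S ℝ) (Δ : Matrix ι ι ℝ) : Matrix ι ι ℝ := E * (Eᵀ * Δ * E)⁻¹ * Eᵀ

/-- `SubReduction.cov` is `redCov`. [folklore] -/
theorem subReduction_cov_eq {N : ℕ} (T : SubReduction d N) : T.cov = redCov T.C T.Δ := rfl

/-- **THE RESOLVENT IDENTITY FOR CONSTRAINED COVARIANCES**: if `EᵀΔ₁E` and `EᵀΔ₂E` are invertible then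
`E(EᵀΔ₁E)⁻¹Eᵀ − E(EᵀΔ₂E)⁻¹Eᵀ = [E(EᵀΔ₁E)⁻¹Eᵀ](Δ₂ − Δ₁)[E(EᵀΔ₂E)⁻¹Eᵀ]` — King's endpoint identity (the s-integral
(4.39) of d/ds C(s) = C(s)(Δ^{(k+n)} − Δ^{(k)})C(s), (4.40)) with the δ-function constraints of (2.152) carried by `E`
instead of the mass term `aL⁻²Q*Q`. [cite: King1986, (4.39)–(4.40) pp.674–675 (mechanism); Balaban1984PropagatorsII, (2.156) p.250 (object)] [folklore] -/
theorem redCov_sub (E : Matrix ι S ℝ) (Δ₁ Δ₂ : Matrix ι ι ℝ) (h1 : IsUnit (Eᵀ * Δ₁ * E).det)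
    (h2 : IsUnit (Eᵀ * Δ₂ * E).det) :
    redCov E Δ₁ - redCov E Δ₂ = redCov E Δ₁ * (Δ₂ - Δ₁) * redCov E Δ₂ := by
  set A₁ := Eᵀ * Δ₁ * E with hA₁
  set A₂ := Eᵀ * Δ₂ * E with hA₂
  have hsand : Eᵀ * (Δ₂ - Δ₁) * E = A₂ - A₁ := by
    rw [Matrix.mul_sub, Matrix.sub_mul]
  -- middle regrouping
  have key : A₁⁻¹ * (Eᵀ * (Δ₂ - Δ₁) * E) * A₂⁻¹ = A₁⁻¹ - A₂⁻¹ := by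
    rw [hsand, Matrix.mul_sub, Matrix.sub_mul, Matrix.mul_assoc A₁⁻¹ A₂ A₂⁻¹, Matrix.mul_nonsing_inv _ h2,
      Matrix.mul_one, Matrix.nonsing_inv_mul _ h1, Matrix.one_mul]
  unfold redCov
  calc E * A₁⁻¹ * Eᵀ - E * A₂⁻¹ * Eᵀ = E * (A₁⁻¹ - A₂⁻¹) * Eᵀ := by
        rw [Matrix.mul_sub, Matrix.sub_mul]
    _ = E * (A₁⁻¹ * (Eᵀ * (Δ₂ - Δ₁) * E) * A₂⁻¹) * Eᵀ := by rw [key]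
    _ = E * A₁⁻¹ * Eᵀ * (Δ₂ - Δ₁) * (E * A₂⁻¹ * Eᵀ) := by
        simp only [Matrix.mul_assoc]

/-- **KING'S (4.41) FOR CONSTRAINED COVARIANCES**: with a pseudo-distance `dist` (nonnegative, triangle inequality),
if both constrained covariances decay (`≤ A e^{−κ dist}`), the difference of the two operators decays with a SMALL
amplitude (`≤ θ e^{−κ dist}`) and the half-rate sums are `≤ V`, then
`|C₁(x,y) − C₂(x,y)| ≤ A·θ·A·V²·e^{−(κ/2) dist(x,y)}` (`redCov_sub` + `King1986.triple_decay_bound`).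
[cite: King1986, (4.40)–(4.41) pp.674–675] [folklore] -/
theorem redCov_rate (dist : ι → ι → ℝ) (hd0 : ∀ i j, 0 ≤ dist i j)
    (htri : ∀ i j k, dist i k ≤ dist i j + dist j k)
    (E : Matrix ι S ℝ) (Δ₁ Δ₂ : Matrix ι ι ℝ) (h1 : IsUnit (Eᵀ * Δ₁ * E).det) (h2 : IsUnit (Eᵀ * Δ₂ * E).det)
    {κ A θ V : ℝ} (hκ : 0 ≤ κ) (hA : 0 ≤ A) (hθ : 0 ≤ θ)
    (hC1 : ∀ x y, |redCov E Δ₁ x y| ≤ A * Real.exp (-(κ * dist x y)))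
    (hC2 : ∀ x y, |redCov E Δ₂ x y| ≤ A * Real.exp (-(κ * dist x y)))
    (hE : ∀ z w, |(Δ₂ - Δ₁) z w| ≤ θ * Real.exp (-(κ * dist z w)))
    (hV : ∀ x, ∑ z, Real.exp (-(κ / 2 * dist x z)) ≤ V) (x y : ι) :
    |redCov E Δ₁ x y - redCov E Δ₂ x y| ≤ A * θ * A * V ^ 2 * Real.exp (-(κ / 2 * dist x y)) := by
  have e : redCov E Δ₁ x y - redCov E Δ₂ x y = (redCov E Δ₁ * (Δ₂ - Δ₁) * redCov E Δ₂) x y := by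
    have := congrArg (fun N : Matrix ι ι ℝ => N x y) (redCov_sub E Δ₁ Δ₂ h1 h2)
    simpa [Matrix.sub_apply] using this
  rw [e]
  exact triple_decay_bound dist hd0 htri (redCov E Δ₁) (Δ₂ - Δ₁) (redCov E Δ₂) hκ hA hθ hC1 hE hC2 hV x y

end Core

/-! ## §3  The torus inputs: invertibility of C_S*Δ_kC_S ((2.157)), the volume-independent sums, monotonicity -/

section TorusInputs

variable {L : ℕ} {M : Fin d → ℕ} [∀ μ, NeZero (M μ)]

/-- (2.157) ⟹ INVERTIBILITY of `C_S*Δ_kC_S` for every sub-family `S` of the remaining variables, Δ_k = `deltaPol M n`: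
`⟨B′, C_S*Δ_kC_SB′⟩ ≥ γ′₀‖C_SB′‖² ≥ γ′₀‖B′‖²` with γ′₀ = `gamma2153 d L` > 0 (`lowerOnConstrainedT_of_represents` on
`C_SB′`, which satisfies the constraints by `q1_elimTS_mulVec` / `elimTS_mulVec_tree`; `elimTS_iso`;
`B6FromB4.sandwich_lowerBound`; `isUnit_det_of_lower`). [cite: Balaban1984PropagatorsII, (2.157) p.250] -/
theorem isUnit_sandwich_subfamily (hd : 2 ≤ d) (hL : 1 ≤ L) (hLM : ∀ i, L ∣ M i) {n : ℕ} (hn : 1 ≤ n)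
    {S : Finset (B4.Idx (pbox M) d)} (hS : S ⊆ freeT L M) :
    IsUnit ((elimTS L M S hS)ᵀ * deltaPol M n * elimTS L M S hS).det := by
  have hd1 : 1 ≤ d := by omega
  have hγ := gamma2153_pos hd1 hL
  have hl : LowerOnConstrainedT L M (deltaPol M n) (gamma2153 d L) :=
    lowerOnConstrainedT_of_represents M hd hL n hn hLM (represents_deltaPol M n)
  have hL0 : 0 < L := hL
  refine isUnit_det_of_lower hγ (B6FromB4.sandwich_lowerBound (elimTS L M S hS) (deltaPol M n) hγ.le
    (fun w => hl _ (fun c hc => q1_elimTS_mulVec hS hL0 hLM w hc) (fun p hp => elimTS_mulVec_tree hS w hp))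
    (fun w => elimTS_iso hS w))

/-- The same for the WHOLE family (C = `elimT`). [cite: Balaban1984PropagatorsII, (2.157) p.250] -/
theorem isUnit_sandwich_torus (hd : 2 ≤ d) (hL : 1 ≤ L) (hLM : ∀ i, L ∣ M i) {n : ℕ} (hn : 1 ≤ n) :
    IsUnit ((elimT L M)ᵀ * deltaPol M n * elimT L M).det := by
  have hd1 : 1 ≤ d := by omega
  have hγ := gamma2153_pos hd1 hL
  have hl : LowerOnConstrainedT L M (deltaPol M n) (gamma2153 d L) :=
    lowerOnConstrainedT_of_represents M hd hL n hn hLM (represents_deltaPol M n)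
  have hL0 : 0 < L := hL
  refine isUnit_det_of_lower hγ (B6FromB4.sandwich_lowerBound (elimT L M) (deltaPol M n) hγ.le
    (fun w => hl _ (fun c hc => q1_elimT_mulVec hL0 hLM w hc) (fun p hp => elimT_mulVec_tree w hp))
    (fun w => elimT_iso w))

omit [∀ μ, NeZero (M μ)] in
/-- The bond pseudo-distance ρ_M(b₋, b′₋) on the torus bonds: nonnegative. [folklore] -/
theorem bondDist_nonneg (hM1 : ∀ i, 1 ≤ M i) (p q : B4.Idx (pbox M) d) :
    0 ≤ pdist M hM1 (p.1 : Fin d → ℤ) (q.1 : Fin d → ℤ) :=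
  pseudo_nonneg (fun p q : B4.Idx (pbox M) d => pdist M hM1 (p.1 : Fin d → ℤ) (q.1 : Fin d → ℤ))
    (fun _ _ => (zdPer d M hM1).ρ_comm _ _) (fun _ => (zdPer d M hM1).ρ_self _)
    (fun _ _ _ => (zdPer d M hM1).ρ_triangle _ _ _) p q

omit [∀ μ, NeZero (M μ)] in
/-- … and satisfies the triangle inequality. [folklore] -/
theorem bondDist_triangle (hM1 : ∀ i, 1 ≤ M i) (p q r : B4.Idx (pbox M) d) :
    pdist M hM1 (p.1 : Fin d → ℤ) (r.1 : Fin d → ℤ)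
      ≤ pdist M hM1 (p.1 : Fin d → ℤ) (q.1 : Fin d → ℤ) + pdist M hM1 (q.1 : Fin d → ℤ) (r.1 : Fin d → ℤ) :=
  (zdPer d M hM1).ρ_triangle _ _ _

omit [∀ μ, NeZero (M μ)] in
/-- THE VOLUME-INDEPENDENT SUMS (King's (iv)): `Σ_{b′} e^{−a ρ_M(b₋,b′₋)} ≤ d·K_d(a)` for every torus and every bond `b`
(`B6BondEliminationTorus.perSum_le` on the box, which is separated). [folklore] -/
theorem bondSum_le (hM1 : ∀ i, 1 ≤ M i) {a : ℝ} (ha : 0 < a) (p : B4.Idx (pbox M) d) :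
    ∑ q : B4.Idx (pbox M) d, Real.exp (-(a * pdist M hM1 (p.1 : Fin d → ℤ) (q.1 : Fin d → ℤ)))
      ≤ (d : ℝ) * B4Sect5Proof.latticeConst d a :=
  perSum_le (N := d) (box_separated M hM1) ha p

end TorusInputs

/-! ## §4  The assembly: the η-rate of C^{(k)} = C(C*Δ_kC)⁻¹C* for every sub-family, the whole torus and every Λ -/

section Assembly

variable (d)

/-- **KERNEL-CHECKED — THE η-RATE OF BAŁABAN'S FLUCTUATION COVARIANCE (2.156) AT U = 1, FOR EVERY SUB-FAMILY C_S,
HYPOTHESIS-FREE.**  Let d ≥ 2, L ≥ 1.  There are C′, δ′ > 0 (depending on d, L only) such that for EVERY unit torus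
(L ∣ M_i), ALL levels n₁ ≥ 1 and n₂ = R·n₁ (R ≥ 1), EVERY sub-family S of the remaining variables and ALL bonds b, b′:
`|C_S^{(n₂)}(b,b′) − C_S^{(n₁)}(b,b′)| ≤ C′·n₁⁻¹·e^{−δ′ρ_M(b₋,b′₋)}`, where C_S^{(n)} = C_S(C_S*Δ^{(n)}C_S)⁻¹C_S*
(`subFamilyT … (deltaPol M n)).cov`).  Chain: `kernelRate166` (middle factor) + `cov2156_torusS_166` (both endpoint
decays) + `isUnit_sandwich_subfamily` ((2.157)) + `bondSum_le` → `redCov_rate` (King (4.40)–(4.41)).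
[cite: King1986, Lemma 4.5 (4.38) p.674 (shape); Balaban1984PropagatorsII, (2.156) p.250 (object)] [folklore] -/
theorem cov2156_rate_subfamily (hd : 2 ≤ d) {L : ℕ} (hL : 1 ≤ L) :
    ∃ C' δ' : ℝ, 0 < C' ∧ 0 < δ' ∧
      ∀ (M : Fin d → ℕ) [∀ μ, NeZero (M μ)], (∀ i, L ∣ M i) →
        ∀ n₁ n₂ R : ℕ, 1 ≤ n₁ → 1 ≤ R → n₂ = R * n₁ →
        ∀ (S : Finset (B4.Idx (pbox M) d)) (hS : S ⊆ freeT L M) (p q : B4.Idx (pbox M) d),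
          |(subFamilyT L M S hS (deltaPol M n₂)).cov p q - (subFamilyT L M S hS (deltaPol M n₁)).cov p q|
            ≤ C' * (n₁ : ℝ)⁻¹ *
                Real.exp (-(δ' * pdist M (one_le_M M) (p.1 : Fin d → ℤ) (q.1 : Fin d → ℤ))) := by
  have hd1 : 1 ≤ d := by omega
  obtain ⟨θ₀, δ₁, hθ₀, hδ₁, hR⟩ := kernelRate166 (d := d) hd1
  obtain ⟨c, δ, hc, hδ, hD⟩ := cov2156_torusS_166 d hd hL
  -- common decay rate κ = min δ δ₁, final rate κ/2
  set κ := min δ δ₁ with hκdef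
  have hκ : 0 < κ := lt_min hδ hδ₁
  have hκδ : κ ≤ δ := min_le_left _ _
  have hκδ₁ : κ ≤ δ₁ := min_le_right _ _
  set V := (d : ℝ) * B4Sect5Proof.latticeConst d (κ / 2) with hV
  refine ⟨c * θ₀ * c * V ^ 2 + 1, κ / 2, by positivity, by positivity, ?_⟩
  intro M _ hLM n₁ n₂ R hn₁ hR1 h S hS p q
  have hn₂ : 1 ≤ n₂ := by subst h; exact Nat.one_le_iff_ne_zero.mpr (Nat.mul_ne_zero (by omega) (by omega))
  set dist : B4.Idx (pbox M) d → B4.Idx (pbox M) d → ℝ :=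
    fun p q => pdist M (one_le_M M) (p.1 : Fin d → ℤ) (q.1 : Fin d → ℤ) with hdist
  have hd0 : ∀ i j, 0 ≤ dist i j := bondDist_nonneg (one_le_M M)
  have htri : ∀ i j k, dist i k ≤ dist i j + dist j k := bondDist_triangle (one_le_M M)
  -- the two endpoint covariances decay at rate κ ≤ δ
  have hC : ∀ n, 1 ≤ n → ∀ x y, |redCov (elimTS L M S hS) (deltaPol M n) x y| ≤ c * Real.exp (-(κ * dist x y)) := by
    intro n hn x y
    have h0 := hD M hLM n hn S hS x y
    rw [subReduction_cov_eq] at h0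
    exact h0.trans (exp_decay_mono hc.le hκδ (hd0 x y))
  -- the middle factor: rate θ₀ n₁⁻¹ at decay κ ≤ δ₁
  have hE : ∀ z w, |(deltaPol M n₂ - deltaPol M n₁) z w| ≤ θ₀ * (n₁ : ℝ)⁻¹ * Real.exp (-(κ * dist z w)) := by
    intro z w
    rw [Matrix.sub_apply]
    have h0 := hR M n₁ n₂ R hn₁ hR1 h z w
    have hθn : 0 ≤ θ₀ * (n₁ : ℝ)⁻¹ := mul_nonneg hθ₀.le (inv_nonneg.mpr (Nat.cast_nonneg _))
    exact h0.trans (exp_decay_mono hθn hκδ₁ (hd0 z w))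
  have hVb : ∀ x, ∑ z, Real.exp (-(κ / 2 * dist x z)) ≤ V := fun x =>
    bondSum_le (one_le_M M) (half_pos hκ) x
  have hθn : 0 ≤ θ₀ * (n₁ : ℝ)⁻¹ := mul_nonneg hθ₀.le (inv_nonneg.mpr (Nat.cast_nonneg _))
  have main := redCov_rate dist hd0 htri (elimTS L M S hS) (deltaPol M n₁) (deltaPol M n₂)
    (isUnit_sandwich_subfamily hd hL hLM hn₁ hS) (isUnit_sandwich_subfamily hd hL hLM hn₂ hS)
    hκ.le hc.le hθn (hC n₁ hn₁) (hC n₂ hn₂) hE hVb p q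
  rw [subReduction_cov_eq, subReduction_cov_eq]
  show |redCov (elimTS L M S hS) (deltaPol M n₂) p q - redCov (elimTS L M S hS) (deltaPol M n₁) p q| ≤ _
  rw [abs_sub_comm]
  refine main.trans ?_
  have hEx := Real.exp_nonneg (-(κ / 2 * dist p q))
  have hn0 : 0 ≤ (n₁ : ℝ)⁻¹ := inv_nonneg.mpr (Nat.cast_nonneg _)
  have e1 : c * (θ₀ * (n₁ : ℝ)⁻¹) * c * V ^ 2 * Real.exp (-(κ / 2 * dist p q))
      = (c * θ₀ * c * V ^ 2) * (n₁ : ℝ)⁻¹ * Real.exp (-(κ / 2 * dist p q)) := by ring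
  rw [e1]
  gcongr
  linarith

/-- **KERNEL-CHECKED — THE η-RATE OF C^{(k)} ON THE WHOLE TORUS (C = `elimT`), HYPOTHESIS-FREE**: the same statement for
`(bondReductionT L M (deltaPol M n)).cov` = C(C*Δ^{(n)}C)⁻¹C* with the full elimination matrix of p. 250 (decay input:
b05-g9's `cov2156_torus_166`). [cite: King1986, Lemma 4.5 (4.38) p.674 (shape); Balaban1984PropagatorsII, (2.156) p.250 (object)] [folklore] -/
theorem cov2156_rate_torus (hd : 2 ≤ d) {L : ℕ} (hL : 1 ≤ L) :
    ∃ C' δ' : ℝ, 0 < C' ∧ 0 < δ' ∧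
      ∀ (M : Fin d → ℕ) [∀ μ, NeZero (M μ)], (∀ i, L ∣ M i) →
        ∀ n₁ n₂ R : ℕ, 1 ≤ n₁ → 1 ≤ R → n₂ = R * n₁ →
        ∀ p q : B4.Idx (pbox M) d,
          |(bondReductionT L M (deltaPol M n₂)).cov p q - (bondReductionT L M (deltaPol M n₁)).cov p q|
            ≤ C' * (n₁ : ℝ)⁻¹ *
                Real.exp (-(δ' * pdist M (one_le_M M) (p.1 : Fin d → ℤ) (q.1 : Fin d → ℤ))) := by
  have hd1 : 1 ≤ d := by omega
  obtain ⟨θ₀, δ₁, hθ₀, hδ₁, hR⟩ := kernelRate166 (d := d) hd1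
  obtain ⟨c, δ, hc, hδ, hD⟩ := cov2156_torus_166 (d := d) hd hL
  set κ := min δ δ₁ with hκdef
  have hκ : 0 < κ := lt_min hδ hδ₁
  have hκδ : κ ≤ δ := min_le_left _ _
  have hκδ₁ : κ ≤ δ₁ := min_le_right _ _
  set V := (d : ℝ) * B4Sect5Proof.latticeConst d (κ / 2) with hV
  refine ⟨c * θ₀ * c * V ^ 2 + 1, κ / 2, by positivity, by positivity, ?_⟩
  intro M _ hLM n₁ n₂ R hn₁ hR1 h p q
  have hn₂ : 1 ≤ n₂ := by subst h; exact Nat.one_le_iff_ne_zero.mpr (Nat.mul_ne_zero (by omega) (by omega))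
  set dist : B4.Idx (pbox M) d → B4.Idx (pbox M) d → ℝ :=
    fun p q => pdist M (one_le_M M) (p.1 : Fin d → ℤ) (q.1 : Fin d → ℤ) with hdist
  have hd0 : ∀ i j, 0 ≤ dist i j := bondDist_nonneg (one_le_M M)
  have htri : ∀ i j k, dist i k ≤ dist i j + dist j k := bondDist_triangle (one_le_M M)
  have hC : ∀ n, 1 ≤ n → ∀ x y, |redCov (elimT L M) (deltaPol M n) x y| ≤ c * Real.exp (-(κ * dist x y)) := by
    intro n hn x y
    have h0 := hD M hLM n hn x y
    rw [subReduction_cov_eq] at h0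
    exact h0.trans (exp_decay_mono hc.le hκδ (hd0 x y))
  have hE : ∀ z w, |(deltaPol M n₂ - deltaPol M n₁) z w| ≤ θ₀ * (n₁ : ℝ)⁻¹ * Real.exp (-(κ * dist z w)) := by
    intro z w
    rw [Matrix.sub_apply]
    have h0 := hR M n₁ n₂ R hn₁ hR1 h z w
    have hθn : 0 ≤ θ₀ * (n₁ : ℝ)⁻¹ := mul_nonneg hθ₀.le (inv_nonneg.mpr (Nat.cast_nonneg _))
    exact h0.trans (exp_decay_mono hθn hκδ₁ (hd0 z w))
  have hVb : ∀ x, ∑ z, Real.exp (-(κ / 2 * dist x z)) ≤ V := fun x =>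
    bondSum_le (one_le_M M) (half_pos hκ) x
  have hθn : 0 ≤ θ₀ * (n₁ : ℝ)⁻¹ := mul_nonneg hθ₀.le (inv_nonneg.mpr (Nat.cast_nonneg _))
  have main := redCov_rate dist hd0 htri (elimT L M) (deltaPol M n₁) (deltaPol M n₂)
    (isUnit_sandwich_torus hd hL hLM hn₁) (isUnit_sandwich_torus hd hL hLM hn₂)
    hκ.le hc.le hθn (hC n₁ hn₁) (hC n₂ hn₂) hE hVb p q
  rw [subReduction_cov_eq, subReduction_cov_eq]
  show |redCov (elimT L M) (deltaPol M n₂) p q - redCov (elimT L M) (deltaPol M n₁) p q| ≤ _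
  rw [abs_sub_comm]
  refine main.trans ?_
  have hEx := Real.exp_nonneg (-(κ / 2 * dist p q))
  have hn0 : 0 ≤ (n₁ : ℝ)⁻¹ := inv_nonneg.mpr (Nat.cast_nonneg _)
  have e1 : c * (θ₀ * (n₁ : ℝ)⁻¹) * c * V ^ 2 * Real.exp (-(κ / 2 * dist p q))
      = (c * θ₀ * c * V ^ 2) * (n₁ : ℝ)⁻¹ * Real.exp (-(κ / 2 * dist p q)) := by ring
  rw [e1]
  gcongr
  linarith

/-- **KERNEL-CHECKED — THE η-RATE OF C^{(k)}_Λ ON EVERY Λ = B(Λ′₀) ⊂ T** (C_Λ = the Λ-bond columns of C,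
`bondReductionLam`): the sub-family statement at S = the Λ-bonds. [cite: King1986, Lemma 4.5 (4.38) p.674 (shape); Balaban1984PropagatorsII, (2.154)–(2.156) pp.249–250 (object)] [folklore] -/
theorem cov2156_rate_lam (hd : 2 ≤ d) {L : ℕ} (hL : 1 ≤ L) :
    ∃ C' δ' : ℝ, 0 < C' ∧ 0 < δ' ∧
      ∀ (M : Fin d → ℕ) [∀ μ, NeZero (M μ)], (∀ i, L ∣ M i) →
        ∀ n₁ n₂ R : ℕ, 1 ≤ n₁ → 1 ≤ R → n₂ = R * n₁ →
        ∀ (Λ'₀ : Finset (Fin d → ℤ)) (p q : B4.Idx (pbox M) d),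
          |(bondReductionLam L M Λ'₀ (deltaPol M n₂)).cov p q - (bondReductionLam L M Λ'₀ (deltaPol M n₁)).cov p q|
            ≤ C' * (n₁ : ℝ)⁻¹ *
                Real.exp (-(δ' * pdist M (one_le_M M) (p.1 : Fin d → ℤ) (q.1 : Fin d → ℤ))) := by
  obtain ⟨C', δ', hC', hδ', H⟩ := cov2156_rate_subfamily d hd hL
  exact ⟨C', δ', hC', hδ', fun M _ hLM n₁ n₂ R hn₁ hR h Λ'₀ p q =>
    H M hLM n₁ n₂ R hn₁ hR h (lamFree L M Λ'₀) (lamFree_subset L M Λ'₀) p q⟩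

/-- **KING'S SHAPE (4.38) FOR BAŁABAN'S C^{(k)} ON THE WHOLE UNIT TORUS**: with n₁ = L^k, n₂ = L^{k+m},
`|C^{(k+m)}(b,b′) − C^{(k)}(b,b′)| ≤ C′·L^{−k}·e^{−δ′ρ_M(b₋,b′₋)}` uniformly in k, m and the torus — *"|C^{(k)}(x, y) −
C^{(k+n)}(x, y)| ≤ CL^{−k}e^{−δ₀|x−y|}. (4.38)"* for the gauge-field fluctuation covariance of (2.152)/(2.156) at U = 1.
[cite: King1986, Lemma 4.5 (4.38) p.674 (shape); Balaban1984PropagatorsII, (2.156) p.250 (object)] [folklore] -/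
theorem cov2156_rate_torus_king (hd : 2 ≤ d) {L : ℕ} (hL : 1 ≤ L) :
    ∃ C' δ' : ℝ, 0 < C' ∧ 0 < δ' ∧
      ∀ (M : Fin d → ℕ) [∀ μ, NeZero (M μ)], (∀ i, L ∣ M i) → ∀ k m : ℕ, ∀ p q : B4.Idx (pbox M) d,
        |(bondReductionT L M (deltaPol M (L ^ (k + m)))).cov p q - (bondReductionT L M (deltaPol M (L ^ k))).cov p q|
          ≤ C' * ((L : ℝ) ^ k)⁻¹ *
              Real.exp (-(δ' * pdist M (one_le_M M) (p.1 : Fin d → ℤ) (q.1 : Fin d → ℤ))) := by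
  obtain ⟨C', δ', hC', hδ', H⟩ := cov2156_rate_torus d hd hL
  refine ⟨C', δ', hC', hδ', fun M _ hLM k m p q => ?_⟩
  have hLk : 1 ≤ L ^ k := Nat.one_le_pow _ _ hL
  have hLm : 1 ≤ L ^ m := Nat.one_le_pow _ _ hL
  have h := H M hLM (L ^ k) (L ^ (k + m)) (L ^ m) hLk hLm (by rw [pow_add, mul_comm]) p q
  simpa using h

/-- The same King shape for every sub-family C_S (hence every Λ ⊂ T). [cite: King1986, Lemma 4.5 (4.38) p.674 (shape); Balaban1984PropagatorsII, (2.156) p.250 (object)] [folklore] -/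
theorem cov2156_rate_subfamily_king (hd : 2 ≤ d) {L : ℕ} (hL : 1 ≤ L) :
    ∃ C' δ' : ℝ, 0 < C' ∧ 0 < δ' ∧
      ∀ (M : Fin d → ℕ) [∀ μ, NeZero (M μ)], (∀ i, L ∣ M i) → ∀ k m : ℕ,
        ∀ (S : Finset (B4.Idx (pbox M) d)) (hS : S ⊆ freeT L M) (p q : B4.Idx (pbox M) d),
        |(subFamilyT L M S hS (deltaPol M (L ^ (k + m)))).cov p q
            - (subFamilyT L M S hS (deltaPol M (L ^ k))).cov p q|
          ≤ C' * ((L : ℝ) ^ k)⁻¹ *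
              Real.exp (-(δ' * pdist M (one_le_M M) (p.1 : Fin d → ℤ) (q.1 : Fin d → ℤ))) := by
  obtain ⟨C', δ', hC', hδ', H⟩ := cov2156_rate_subfamily d hd hL
  refine ⟨C', δ', hC', hδ', fun M _ hLM k m S hS p q => ?_⟩
  have hLk : 1 ≤ L ^ k := Nat.one_le_pow _ _ hL
  have hLm : 1 ≤ L ^ m := Nat.one_le_pow _ _ hL
  have h := H M hLM (L ^ k) (L ^ (k + m)) (L ^ m) hLk hLm (by rw [pow_add, mul_comm]) S hS p q
  simpa using h

/-- **THE (UNIFORM DECAY, ONE-STEP RATE) PAIR FOR Γ_k = C^{(k)}(𝟙) AT U = 1** — the cell's LIAISON-U1 primitive P1 in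
the shape its β-side consumers read (decay `B₀e^{−δ₀ρ}` for every k, one-step difference `B₀e^{−δ₀ρ}θ^k` with
θ = L⁻¹; θ < 1 needs L ≥ 2): ONE (B₀, δ₀) depending on (d, L) only, for every torus, k, b, b′.  (Decay: b05-g9's
`cov2156_torus_166`; rate: `cov2156_rate_torus_king` at m = 1.) [cite: King1986, Lemma 4.5 (4.38) p.674 (shape); Balaban1984PropagatorsII, (2.156) p.250 (object)] [folklore] -/
theorem cov2156_pair_torus (hd : 2 ≤ d) {L : ℕ} (hL : 1 ≤ L) :
    ∃ B₀ δ₀ : ℝ, 0 < B₀ ∧ 0 < δ₀ ∧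
      ∀ (M : Fin d → ℕ) [∀ μ, NeZero (M μ)], (∀ i, L ∣ M i) → ∀ k : ℕ, ∀ p q : B4.Idx (pbox M) d,
        |(bondReductionT L M (deltaPol M (L ^ k))).cov p q|
            ≤ B₀ * Real.exp (-(δ₀ * pdist M (one_le_M M) (p.1 : Fin d → ℤ) (q.1 : Fin d → ℤ))) ∧
        |(bondReductionT L M (deltaPol M (L ^ (k + 1)))).cov p q - (bondReductionT L M (deltaPol M (L ^ k))).cov p q|
            ≤ B₀ * Real.exp (-(δ₀ * pdist M (one_le_M M) (p.1 : Fin d → ℤ) (q.1 : Fin d → ℤ))) *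
                ((L : ℝ)⁻¹) ^ k := by
  obtain ⟨c, δ, hc, hδ, hD⟩ := cov2156_torus_166 (d := d) hd hL
  obtain ⟨C', δ', hC', hδ', H⟩ := cov2156_rate_torus_king d hd hL
  set κ := min δ δ' with hκ
  have hκ0 : 0 < κ := lt_min hδ hδ'
  refine ⟨max c C', κ, lt_max_of_lt_left hc, hκ0, fun M _ hLM k p q => ⟨?_, ?_⟩⟩
  · have h0 := hD M hLM (L ^ k) (Nat.one_le_pow _ _ hL) p q
    have hdd := bondDist_nonneg (one_le_M M) p q
    calc _ ≤ c * Real.exp (-(δ * pdist M (one_le_M M) (p.1 : Fin d → ℤ) (q.1 : Fin d → ℤ))) := h0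
      _ ≤ c * Real.exp (-(κ * pdist M (one_le_M M) (p.1 : Fin d → ℤ) (q.1 : Fin d → ℤ))) :=
          exp_decay_mono hc.le (min_le_left _ _) hdd
      _ ≤ max c C' * Real.exp (-(κ * pdist M (one_le_M M) (p.1 : Fin d → ℤ) (q.1 : Fin d → ℤ))) :=
          mul_le_mul_of_nonneg_right (le_max_left _ _) (Real.exp_nonneg _)
  · have h0 := H M hLM k 1 p q
    have hdd := bondDist_nonneg (one_le_M M) p q
    have hLpos : (0 : ℝ) < L := by exact_mod_cast hL
    have e1 : ((L : ℝ) ^ k)⁻¹ = ((L : ℝ)⁻¹) ^ k := by rw [inv_pow]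
    calc _ ≤ C' * ((L : ℝ) ^ k)⁻¹ * Real.exp (-(δ' * pdist M (one_le_M M) (p.1 : Fin d → ℤ) (q.1 : Fin d → ℤ))) := h0
      _ = C' * Real.exp (-(δ' * pdist M (one_le_M M) (p.1 : Fin d → ℤ) (q.1 : Fin d → ℤ))) * ((L : ℝ)⁻¹) ^ k := by
          rw [e1]; ring
      _ ≤ C' * Real.exp (-(κ * pdist M (one_le_M M) (p.1 : Fin d → ℤ) (q.1 : Fin d → ℤ))) * ((L : ℝ)⁻¹) ^ k := by
          have := exp_decay_mono hC'.le (min_le_right δ δ') hdd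
          exact mul_le_mul_of_nonneg_right this (pow_nonneg (inv_nonneg.mpr hLpos.le) _)
      _ ≤ max c C' * Real.exp (-(κ * pdist M (one_le_M M) (p.1 : Fin d → ℤ) (q.1 : Fin d → ℤ))) * ((L : ℝ)⁻¹) ^ k := by
          have h1 := mul_le_mul_of_nonneg_right (le_max_right c C') (Real.exp_nonneg
            (-(κ * pdist M (one_le_M M) (p.1 : Fin d → ℤ) (q.1 : Fin d → ℤ))))
          exact mul_le_mul_of_nonneg_right h1 (pow_nonneg (inv_nonneg.mpr hLpos.le) _)

end Assembly

/-! ## §5  The cell's typed shape: `T4EtaRateMin.LocalRate` for the readings k ↦ C^{(k)}(b,b′) at U = 1, and King's use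
of (4.38) — the k → ∞ limit of every entry exists on each fixed unit torus (L ≥ 2) -/

section TypedShape

variable (d)

/-- THE READINGS OF THE FLUCTUATION COVARIANCE AT U = 1 ON A FIXED UNIT TORUS, as an instance of the cell's abstract
carrier `T4EtaRateMin.Readings`: the datum type is `Unit` (U = 1 is the only datum of the linear theory), the sites
are the bond pairs, `loc k _ (b,b′) := C^{(k)}(b,b′)` with C^{(k)} = C(C*Δ^{(L^k)}C)⁻¹C* on the whole torus; the scalar
reading and the volume factor are unused and set to `0`. [folklore] -/
def covReadings (L : ℕ) (M : Fin d → ℕ) [∀ μ, NeZero (M μ)] :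
    Readings Unit (B4.Idx (pbox M) d × B4.Idx (pbox M) d) where
  dom := Set.univ
  act := fun _ _ => 0
  loc := fun k _ x => (bondReductionT L M (deltaPol M (L ^ k))).cov x.1 x.2
  vol := 0
  vol_nonneg := le_rfl

/-- **THE TYPED SHAPE `LocalRate` HOLDS FOR Γ_k = C^{(k)}(𝟙)** with ONE constant B₀(d, L) for every unit torus
(L ∣ M_i) and rate θ = L⁻¹: `|C^{(k+1)}(b,b′) − C^{(k)}(b,b′)| ≤ B₀·(L⁻¹)^k` (the decay factor of `cov2156_pair_torus`
dropped, e^{−δ₀ρ} ≤ 1).  This is an INSTANCE (a theorem), not a hypothesis. [cite: King1986, Lemma 4.5 (4.38) p.674 (shape)] [folklore] -/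
theorem cov2156_localRate (hd : 2 ≤ d) {L : ℕ} (hL : 1 ≤ L) :
    ∃ B₀ : ℝ, 0 < B₀ ∧ ∀ (M : Fin d → ℕ) [∀ μ, NeZero (M μ)], (∀ i, L ∣ M i) →
      LocalRate (covReadings d L M) B₀ ((L : ℝ)⁻¹) := by
  obtain ⟨B₀, δ₀, hB₀, hδ₀, H⟩ := cov2156_pair_torus d hd hL
  refine ⟨B₀, hB₀, fun M _ hLM k _ _ x => ?_⟩
  have h := (H M hLM k x.1 x.2).2
  have hdd := bondDist_nonneg (one_le_M M) x.1 x.2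
  have hex : Real.exp (-(δ₀ * pdist M (one_le_M M) (x.1.1 : Fin d → ℤ) (x.2.1 : Fin d → ℤ))) ≤ 1 :=
    Real.exp_le_one_iff.mpr (by nlinarith)
  have hLpos : (0 : ℝ) ≤ (L : ℝ)⁻¹ := inv_nonneg.mpr (Nat.cast_nonneg _)
  calc |(covReadings d L M).loc (k + 1) _ x - (covReadings d L M).loc k _ x|
      ≤ B₀ * Real.exp (-(δ₀ * pdist M (one_le_M M) (x.1.1 : Fin d → ℤ) (x.2.1 : Fin d → ℤ))) * ((L : ℝ)⁻¹) ^ k := h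
    _ ≤ B₀ * 1 * ((L : ℝ)⁻¹) ^ k := by gcongr
    _ = B₀ * ((L : ℝ)⁻¹) ^ k := by ring

/-- **KING'S USE OF (4.38) — "the required convergence properties of C^{(k)}" (p. 674) — FOR BAŁABAN'S (2.156) AT
U = 1**: for L ≥ 2, on every fixed unit torus (L ∣ M_i) every entry C^{(k)}(b,b′) of the fluctuation covariance
CONVERGES as k → ∞ (lattice spacing L^{−k} → 0 at fixed unit volume), with the geometric tail
`|C^{(k)}(b,b′) − lim| ≤ B₀L^{−k}/(1 − L⁻¹)` (`T4EtaRateMin.LocalRate.exists_limit`).  A statement about a sequence of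
finite matrices; NOT about any measure, NOT infinite volume. [cite: King1986, Lemma 4.5 (4.38) p.674 and the sentence before it] [folklore] -/
theorem cov2156_entry_limit (hd : 2 ≤ d) {L : ℕ} (hL : 2 ≤ L) :
    ∃ B₀ : ℝ, 0 < B₀ ∧ ∀ (M : Fin d → ℕ) [∀ μ, NeZero (M μ)], (∀ i, L ∣ M i) → ∀ p q : B4.Idx (pbox M) d,
      ∃ a : ℝ, Filter.Tendsto (fun k : ℕ => (bondReductionT L M (deltaPol M (L ^ k))).cov p q) Filter.atTop (nhds a) ∧
        ∀ k : ℕ, |(bondReductionT L M (deltaPol M (L ^ k))).cov p q - a| ≤ B₀ * ((L : ℝ)⁻¹) ^ k / (1 - (L : ℝ)⁻¹) := by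
  have hL1 : 1 ≤ L := by omega
  obtain ⟨B₀, hB₀, H⟩ := cov2156_localRate d hd hL1
  refine ⟨B₀, hB₀, fun M _ hLM p q => ?_⟩
  have hθ : ((L : ℝ)⁻¹) < 1 := by
    have : (1 : ℝ) < L := by exact_mod_cast hL
    exact inv_lt_one_of_one_lt₀ this
  exact (H M hLM).exists_limit hθ (V := ()) (Set.mem_univ _) (p, q)

end TypedShape

end Literature.MathematicalPhysics.QuantumFieldTheory.Balaban1983to89.T4Cov2156Rate

end
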